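import Summits.Langlands.Langlands.Theorems.AbelianSurfaceSerreSerreGSp4SurjectiveSingerFamilyDefs
import Summits.Langlands.Langlands.Theorems.AbelianSurfaceSerreSerreGSp4SurjectiveStubIrredOfResidual
import Literature.NumberTheory.GaloisRepresentations.CyclotomicPowerTwistProofs
import Literature.NumberTheory.Automorphic.LocalGlobalAtPUnramified
import HarnessLib

/-!
# Crux `SerreGSp4Surjective` (stmt-Langlands-17765), line `singer-type-evaporation`:
# stub 5/7 `stub_ordinaryEndgame` — the endgame at `p` (local–global compatibility at `ℓ = p`
# plus cyclotomic-twist glue), conditional on the named fact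
# `Caraiani2014_crystalline_unramified_rat_GL4`

Registered signature (skeleton v8.1):
`∃ p₅, ∀ p ≥ p₅, ∀ ρ̄ : Γ_ℚ → GL₄(𝔽_p), IrredOnCycKernel p ρ̄ → ∀ L : OrdinaryLift p ρ̄,
AutomorphicAE p L.lift → RegularOrdinaryModular p ρ̄`.

Proved here as `stub_ordinaryEndgame_of : Caraiani2014_crystalline_unramified_rat_GL4 → <that>`,
the accepted named fact `Literature.NumberTheory.Automorphic.Caraiani2014_crystalline_unramified_rat_GL4`
(p167928; Caraiani 2014, Thm. 1.1 / Barnet-Lamb–Gee–Geraghty–Taylor, *Local–global compatibility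
for `l = p` II*, Cor. 1.2, over `ℚ`, `n = 4`, in the form "`r` crystalline at `p` ⇒ `π_p`
unramified") being its only non-proved input, exactly as the landed
`stub_automorphyLifting : BLGGT2014_thm421_rat_GL4 → …` (p157628).

## The argument (all steps but (ii) kernel-checked below)

Let `L` be an `OrdinaryLift` of `ρ̄` (symplectic with multiplier `ε_p⁻¹`, unramified a.e.,
crystalline at `p`, Greenberg-ordinary on `Γ_{ℚ_p}` with integer exponents `-b`, `b` strictly
increasing, reducing to `ρ̄` along some `red`) and `(π, ι)` a regular algebraic cuspidal `π` on
`GL₄(𝔸_ℚ)` attached to `L.lift` a.e. (`AutomorphicAE`, HLTT normalisation `m = 4`).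
(i) `L.lift` is irreducible: `stub_irredOfResidual` (landed) with `k = 𝔽_p` and the hypothesis
`IrredOnCycKernel p ρ̄`.  (ii) `π` is unramified at `p`: the named fact.  (iii) Put
`k := m (p - 1)` with `m := (-b 0)⁺`, `χ := ε_p^{-k}` (`(cyclotomicPadicAlgCl ℚ p ^ k)⁻¹`) and
`r := L.lift ⊗ χ` (`FramedRep.twist`); the transports along this twist are the accepted
`Literature/NumberTheory/GaloisRepresentations/CyclotomicPowerTwistProofs.lean` (p166443).  Then:
`r|Γ_{ℚ_v}` (`v ∣ p`) is ordinary with exponents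
`-b - k` (`isCrystallineOrdinaryOfExponents_toLocal_twist`: `toLocal` of a twist is the twist of
`toLocal`, scalars are central, and `ε_p ∘ res_v = ε_{ℚ_v}`, tree
`cyclotomicCharacter_absGaloisRestrict`), i.e. of the strictly increasing `ℕ`-shape `a = b + k`
(bridge `isCrystallineOrdinaryOfShapeAt_iff_isCrystallineOrdinaryOfExponents`); `r` is symplectic
with multiplier `χ² ε⁻¹`; `r` is unramified wherever `L.lift` is, away from `p` (`ε_p` is
unramified away from `p`); at an arithmetic Frobenius `σ` at such a place,
`charpoly r(σ) = charpoly (q_v^{-k} · L.lift(σ)) = (charpoly L.lift(σ)).scaleRoots q_v^{-k}`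
(`charpoly_smul_of_ne_zero`, `ε_p(σ) = q_v`), which is the `m = 4` Frobenius polynomial of the
Satake parameter `q_v^{k} · a_v` of the cuspidal twist `π ⊗ |det|^{-k}`
(`exists_twist_hasInfinityType`; regular algebraic, and unramified at `p` with `π`); finally
`charpoly r(g) = (charpoly L.lift(g)).scaleRoots χ(g)` with `χ(g) = u^{p-1}`, `u ∈ ℤ_pˣ`, and
every ring map out of `ℤ_p` killing `p` kills `u^{p-1} - 1 ∈ pℤ_p`, so the integral model
`P.scaleRoots χ(g)` of `charpoly r(g)` reduces along the SAME `red` to `charpoly ρ̄(g)`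
(`reducesAlong_twist`).  Assembling gives `RegularOrdinaryModular p ρ̄` verbatim; `p₅ = 0`.

References: Caraiani 2014 (Algebra Number Theory 8), Thm. 1.1; Barnet-Lamb–Gee–Geraghty–Taylor,
*Local–global compatibility for l = p, II* (Ann. Sci. ÉNS 47, 2014), Thm. 1.1, Cor. 1.2;
Barnet-Lamb–Gee–Geraghty–Taylor 2014 (Annals 179), §2.1; Jacquet–Shalika 1981, Thm. 4.8.
-/

set_option linter.dupNamespace false -- `Summit.Langlands.Langlands` is the mandated namespace

namespace Summit.Langlands.Langlands.Cruxes.SerreGSp4Surjective.SingerTypeEvaporation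

open Literature.NumberTheory.GaloisRepresentations Literature.NumberTheory.Automorphic
  Literature.NumberTheory.PAdicHodge
open scoped NumberField
open IsDedekindDomain Polynomial Filter

noncomputable section

/-! ## The named fact

The only non-proved input is the accepted named fact
`Literature.NumberTheory.Automorphic.Caraiani2014_crystalline_unramified_rat_GL4`
(`Literature/NumberTheory/Automorphic/LocalGlobalAtPUnramified.lean`, p167928): for `π` regular
algebraic cuspidal on `GL₄(𝔸_ℚ)` and `r : Γ_ℚ → GL₄(ℚ̄_p)` irreducible, symplectic with multiplier
`ε_p⁻¹`, attached to `(π, ι)` a.e. (`m = 4`) and crystalline at `v ∣ p`, `π` is unramified at `v`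
(Caraiani 2014 Thm. 1.1 with [BLGGT, `l = p` II] Cor. 1.2; see that file's docstring for the
printed statements and the rendering). -/

/-! ## The Frobenius polynomial of a Satake parameter under the twist -/

/-- **The `m`-normalised Frobenius polynomial of a Satake parameter, with roots scaled by
`q^{-k}`, is that of the parameter `q^{k} · α`** — the Satake parameter of `π ⊗ |det|^{-k}`
(`HasSatakeParamAt.of_map_mulChar_detTwist_of_cpow` with `s = -k`: `q^{-s} α`). [folklore] -/
theorem arithFrobPolyOfSatake_scaleRoots_pow_inv {ℓ : ℕ} [Fact ℓ.Prime] (ι : PadicAlgCl ℓ ≃+* ℂ)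
    (q m k : ℕ) (α : Multiset ℂ) :
    (arithFrobPolyOfSatake ι q m α).scaleRoots (((q : PadicAlgCl ℓ) ^ k)⁻¹) =
      arithFrobPolyOfSatake ι q m (α.map fun x => (q : ℂ) ^ (-(((-(k : ℝ)) : ℝ) : ℂ)) * x) := by
  have hz : (q : ℂ) ^ (-(((-(k : ℝ)) : ℝ) : ℂ)) = (q : ℂ) ^ k := by
    rw [Complex.ofReal_neg, neg_neg, Complex.ofReal_natCast, Complex.cpow_natCast]
  simp only [arithFrobPolyOfSatake, hz]
  have e1 : (α.map fun a => X - C (ι.symm ((((Real.sqrt q : ℝ) : ℂ) ^ (m - 1) * a)⁻¹))) =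
      (α.map fun a => ι.symm ((((Real.sqrt q : ℝ) : ℂ) ^ (m - 1) * a)⁻¹)).map fun b => X - C b := by
    rw [Multiset.map_map]; rfl
  rw [e1, multiset_prod_X_sub_C_scaleRoots, Multiset.map_map, Multiset.map_map]
  congr 1
  refine Multiset.map_congr rfl fun a _ => ?_
  simp only [Function.comp_apply]
  congr 2
  rw [mul_left_comm _ ((q : ℂ) ^ k) a, mul_inv ((q : ℂ) ^ k)]
  simp only [map_mul, map_inv₀, map_pow, map_natCast]
  ring

/-! ## The reduction device survives the twist by `ε_p^{-m(p-1)}` -/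

/-- **Twisting by a character with residually trivial integral values preserves `ReducesAlong`**:
if `charpoly r(g)` has the integral model `P` reducing to `charpoly ρ'(g)` along `red`, and
`χ(g) = u ∈ 𝒪` with `red u = 1`, then `P.scaleRoots u` is an integral model of
`charpoly (r ⊗ χ)(g) = (charpoly r(g)).scaleRoots χ(g)` reducing to
`(charpoly ρ'(g)).scaleRoots 1 = charpoly ρ'(g)`. [folklore] -/
theorem reducesAlong_twist {ℓ : ℕ} [Fact ℓ.Prime] {k : Type} [Field k] [TopologicalSpace k]
    {red : (Valued.v : Valuation (PadicAlgCl ℓ) NNReal).valuationSubring →+* AlgebraicClosure k}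
    {r : FramedGaloisRep ℚ (PadicAlgCl ℓ) 4} {ρ' : FramedGaloisRep ℚ k 4}
    (h : ReducesAlong ℓ red r ρ') (χ : Field.absoluteGaloisGroup ℚ →ₜ* (PadicAlgCl ℓ)ˣ)
    (hχ : ∀ g : Field.absoluteGaloisGroup ℚ,
      ∃ u : (Valued.v : Valuation (PadicAlgCl ℓ) NNReal).valuationSubring,
        (u : PadicAlgCl ℓ) = χ g ∧ red u = 1) :
    ReducesAlong ℓ red (FramedRep.twist r χ) ρ' := by
  intro g
  obtain ⟨P, hP, hPred⟩ := h g
  obtain ⟨u, hu, hred⟩ := hχ g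
  have hinj : Function.Injective
      (Valued.v : Valuation (PadicAlgCl ℓ) NNReal).valuationSubring.subtype :=
    Subtype.coe_injective
  have hmonic : P.Monic := by
    refine Polynomial.monic_of_injective hinj ?_
    rw [hP]
    exact Matrix.charpoly_monic _
  refine ⟨P.scaleRoots u, ?_, ?_⟩
  · rw [Polynomial.map_scaleRoots _ _ _ (by rw [hmonic.leadingCoeff, map_one]; exact one_ne_zero), hP]
    unfold FramedRep.charpoly
    rw [FramedRep.coe_twist_apply, charpoly_smul_of_ne_zero (Units.ne_zero _), ← hu]
    rfl
  · rw [Polynomial.map_scaleRoots _ _ _ (by rw [hmonic.leadingCoeff, map_one]; exact one_ne_zero),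
      hPred, hred, scaleRoots_one]

/-- The values of `ε_p^{-m(p-1)}` are integral and residually trivial along any
`red : 𝒪_{ℚ̄_p} → 𝔽̄`, `𝔽` of characteristic `p`. [folklore] -/
theorem exists_integral_cycPowInv_red_eq_one {p : ℕ} [Fact p.Prime] {k : Type} [Field k]
    [CharP k p]
    (red : (Valued.v : Valuation (PadicAlgCl p) NNReal).valuationSubring →+* AlgebraicClosure k)
    (m : ℕ) (g : Field.absoluteGaloisGroup ℚ) :
    ∃ u : (Valued.v : Valuation (PadicAlgCl p) NNReal).valuationSubring,
      (u : PadicAlgCl p) =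
          ((cyclotomicPadicAlgCl ℚ p ^ (m * (p - 1)))⁻¹ :
            Field.absoluteGaloisGroup ℚ →ₜ* (PadicAlgCl p)ˣ) g ∧
        red u = 1 := by
  set w : ℤ_[p]ˣ := (GaloisRep.cyclotomicCharacter ℚ p g)⁻¹ ^ m with hw
  set φ : ℤ_[p] →+* (Valued.v : Valuation (PadicAlgCl p) NNReal).valuationSubring :=
    (algebraMap ℤ_[p] (PadicAlgCl p)).codRestrict _ algebraMap_padicInt_mem_valuationSubring with hφ
  refine ⟨φ ((w : ℤ_[p]) ^ (p - 1)), ?_, ?_⟩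
  · rw [coe_cycPowInv_apply_eq_algebraMap]
    rfl
  · have hp : (p : AlgebraicClosure k) = 0 := by
      rw [← map_natCast (algebraMap k (AlgebraicClosure k)), CharP.cast_eq_zero, map_zero]
    exact map_units_pow_sub_one_eq_one (red.comp φ) hp w

/-! ## The stub, conditional on the named fact -/

/-- **Stub `stub_ordinaryEndgame`, conditional on `Caraiani2014_crystalline_unramified_rat_GL4`**
(the registered signature with the named fact as leading antecedent).  See the module docstring
for the proof; `p₅ = 0`. [cite: Caraiani2014, Thm. 1.1] -/
theorem stub_ordinaryEndgame_of (hLG : Caraiani2014_crystalline_unramified_rat_GL4) :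
    ∃ p₅ : ℕ, ∀ (p : ℕ) [Fact p.Prime], p₅ ≤ p → ∀ ρ : FramedGaloisRep ℚ (ZMod p) 4,
      IrredOnCycKernel p ρ → ∀ L : OrdinaryLift p ρ,
        AutomorphicAE p L.lift → RegularOrdinaryModular p ρ := by
  refine ⟨0, fun p _ _ ρ hirr L haut => ?_⟩
  have hpr : p.Prime := Fact.out
  haveI : NeZero (4 : ℕ) := ⟨by norm_num⟩
  obtain ⟨hcpt, π, ι, hRA, hsat⟩ := haut
  obtain ⟨red, hred⟩ := L.lift_reducesTo
  -- (i) the lift is irreducible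
  have hirrL : L.lift.toGaloisRep.IsIrreducible :=
    stub_irredOfResidual p L.lift (ZMod p) ρ red hred hirr
  -- (ii) `π` is unramified at `p` (the named fact)
  have hπp : ∀ v : HeightOneSpectrum (𝓞 ℚ), ((p : ℕ) : 𝓞 ℚ) ∈ v.asIdeal → π.1.IsUnramifiedAt v :=
    fun v hv => hLG p hcpt π ι L.lift hRA hirrL L.lift_symplectic hsat v hv (L.lift_crystalline v hv).1
  -- (iii) the twist `r = lift ⊗ ε^{-k}`, `k = m (p - 1) ≥ -b 0`
  set m : ℕ := (-(L.b 0)).toNat with hm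
  set k : ℕ := m * (p - 1) with hkdef
  have hk : ∀ i, 0 ≤ L.b i + k := fun i => by
    have h0 : L.b 0 ≤ L.b i := L.b_strictMono.monotone (Fin.zero_le i)
    have h1 : -(L.b 0) ≤ (m : ℤ) := Int.self_le_toNat _
    have h2 : (m : ℤ) ≤ (k : ℤ) := by
      rw [hkdef]
      exact_mod_cast Nat.le_mul_of_pos_right m (Nat.sub_pos_of_lt hpr.one_lt)
    omega
  set a : Fin 4 → ℕ := fun i => (L.b i + k).toNat with hadef
  have ha : StrictMono a := fun i j hij => by
    have hlt : L.b i + k < L.b j + k := by simpa using L.b_strictMono hij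
    exact (Int.toNat_lt_toNat ((hk i).trans_lt hlt)).mpr hlt
  have hashape : (fun i => -((a i : ℕ) : ℤ)) = fun i => -(L.b i) - (k : ℤ) := by
    funext i
    rw [hadef]
    dsimp only
    rw [Int.toNat_of_nonneg (hk i)]
    ring
  set χ : Field.absoluteGaloisGroup ℚ →ₜ* (PadicAlgCl p)ˣ := (cyclotomicPadicAlgCl ℚ p ^ k)⁻¹
    with hχdef
  set r : FramedGaloisRep ℚ (PadicAlgCl p) 4 := FramedRep.twist L.lift χ with hrdef
  -- the automorphic twist `π' = π ⊗ |det|^{-k}`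
  obtain ⟨T, hT, hTC, hTreg⟩ := hRA
  obtain ⟨χA, π', hχA, hW, hW', hT'⟩ := π.exists_twist_hasInfinityType (-(k : ℝ)) hT
  have hC' : (T.twist (((-(k : ℝ)) : ℝ) : ℂ)).IsCAlgebraic := by
    rw [InfinityType.isCAlgebraic_iff_isLAlgebraic_twist, InfinityType.twist_twist]
    have h1 := ((InfinityType.isCAlgebraic_iff_isLAlgebraic_twist T).mp hTC).twist_intCast (-(k : ℤ))
    rw [InfinityType.twist_twist] at h1
    convert h1 using 2
    push_cast
    ring
  refine ⟨hcpt, π', ι, r, ⟨_, hT', hC', hTreg.twist _⟩, fun v hv => ⟨?_, a, ha, ?_⟩, ?_,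
    ⟨_, isSymplecticWithMultiplierFun_twist L.lift L.lift_symplectic χ⟩,
    ⟨red, reducesAlong_twist hred χ (exists_integral_cycPowInv_red_eq_one red m)⟩⟩
  · -- `π'` is unramified at `v ∣ p`
    obtain ⟨α, hα⟩ := hπp v hv
    exact ⟨_, hα.of_map_mulChar_detTwist_of_cpow hχA hW hW'⟩
  · -- `r` is crystalline-ordinary of shape `a` at `v ∣ p`
    rw [FramedGaloisRep.isCrystallineOrdinaryOfShapeAt_iff_isCrystallineOrdinaryOfExponents, hashape]
    exact isCrystallineOrdinaryOfExponents_toLocal_twist L.lift v k (L.lift_ordinary v hv)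
  · -- Satake–Frobenius compatibility of `r` with `π'` at almost all places
    filter_upwards [hsat, eventually_natCast_not_mem_asIdeal (K := ℚ) hpr.ne_zero] with v hv hvp
    obtain ⟨s, hs, hur, hP⟩ := hv
    refine ⟨_, hs.of_map_mulChar_detTwist_of_cpow hχA hW hW',
      isUnramifiedAt_twist_cycPowInv L.lift hvp hur k, ?_⟩
    rw [← arithFrobPolyOfSatake_scaleRoots_pow_inv]
    exact hasFrobCharpolyAt_twist_cycPowInv L.lift hvp hP k

/-- **Stub 5/7 `stub_ordinaryEndgame` (registered signature, verbatim; skeleton v8.2).**  The named fact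
`Caraiani2014_crystalline_unramified_rat_GL4` (Caraiani 2014 Thm 1.1, `ℓ = p` local–global compatibility:
crystalline ⇒ `π_p` unramified; p167928) is the leading antecedent; the rest is `stub_ordinaryEndgame_of`.
[cite: Caraiani2014, Thm. 1.1] -/
theorem stub_ordinaryEndgame :
    Caraiani2014_crystalline_unramified_rat_GL4 →
    ∃ p₅ : ℕ, ∀ (p : ℕ) [Fact p.Prime], p₅ ≤ p → ∀ ρ : FramedGaloisRep ℚ (ZMod p) 4,
      IrredOnCycKernel p ρ → ∀ L : OrdinaryLift p ρ,
        AutomorphicAE p L.lift → RegularOrdinaryModular p ρ :=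
  fun hLG => stub_ordinaryEndgame_of hLG

end

end Summit.Langlands.Langlands.Cruxes.SerreGSp4Surjective.SingerTypeEvaporation
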